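import Summits.QuantumFields.YangMills.Theorems.BalabanUVNodesN08AxialLaunderingFreeEnd

/-!
# BalabanUVNodes ∕ N08 — THE ABSTRACT WEIL-LAUNDERING CORE: a weighted push-forward INTO a coarse gauge-field space is an exact multiple of product Haar as soon as the source carries
# measure-preserving, weight-fixing symmetries realising the RIGHT translations of the coarse bonds in `T` and the LEFT translations of those outside `T`

Track A, DAG node N08 ([Balaban1985UV3] Thm 1 p. 257 ∕ Thm 2 p. 272; averaging [Balaban1987RG1] (0.4) p. 253).  Cell `pub-ymgap`, seat `pub-ymgap-dag-n08-d` g47 (R529-ym job; DESIGN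
memo (M4)); `--supports stmt-QuantumFields-19936` (helper).  = the proof of ✓p755310 `…AxialLaunderingFreeEnd.map_withDensity_axialAvg_eq_smul_of_freeEnd` with the map `axialAvg`
replaced by an ARBITRARY measurable `Φ : X → GaugeField P (j+1) G` on an arbitrary source `(X, μ)` — the form the CROSS-LEVEL statements need (`Φ` = a composite of hybrid steps, `X` =
the fine fields two or more levels down).

CONTENTS ([folklore]; 0 `def`, 0 `sorry`): ★★★ `map_withDensity_eq_smul_of_translations` — hypotheses: `f ≥ 0` measurable with `∫⁻ f dμ ≠ ∞`; for every coarse field `h` supported on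
`T` a `μ`-preserving `R` with `f ∘ R = f` and `Φ ∘ R = (· * h) ∘ Φ`; for every `h` supported off `T` a `μ`-preserving `L` with `f ∘ L = f` and `Φ ∘ L = (h * ·) ∘ Φ`; conclusion
`(μ.withDensity f).map Φ = (∫⁻ f dμ) • dU_{j+1}`.  ★ `map_eq_haar_of_translations` — the unweighted probability form (`μ` a probability, `f ≡ 1`).
HONEST: count-neutral helper; hTop ∕ (a)′∀ ∕ hJ NOT proved; N08 NOT discharged; R3 ≠ d = 4 ∕ mass gap ∕ Clay.
-/

noncomputable section

open MeasureTheory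
open scoped ENNReal

namespace Summit.QuantumFields.YangMills.Theorems.BalabanUVNodesN08LaunderingAbstract

open Literature.MathematicalPhysics.QuantumFieldTheory.Balaban1983to89
open Literature.MathematicalPhysics.QuantumFieldTheory.Balaban1983to89.AveragingRT (measure_eq_mass_smul_of_invariant measurePreserving_mulLeft)
open Summit.QuantumFields.YangMills.Theorems.BalabanUVNodesN08AxialLaunderingWeighted (map_withDensity_eq_of_comp_eq)
open Summit.QuantumFields.YangMills.Theorems.BalabanUVNodesN08AxialLaunderingFreeEnd (measurable_invOff invOff_invOff map_invOff_fieldMeasure)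

variable {P : Params} {j : ℕ} {G : Type*} [GaugeGroup G] [MeasurableSpace G] [HaarData G] [MeasurableMul₂ G] [MeasurableInv G]
  {X : Type*} [MeasurableSpace X]

/-- ★★★ **THE ABSTRACT WEIL-LAUNDERING CORE.**  `μ` a measure on `X`, `f ≥ 0` measurable with finite integral, `Φ : X → GaugeField P (j+1) G` measurable, `T` a set of coarse bonds.
If every right translation by a coarse field supported on `T`, and every left translation by one supported off `T`, is realised on the source by a `μ`-preserving map fixing `f`
(`Φ ∘ R = (· * h) ∘ Φ`, resp. `Φ ∘ L = (h * ·) ∘ Φ`), then `(μ.withDensity f).map Φ = (∫⁻ f dμ) • dU_{j+1}` (partial coordinatewise inversion off `T` + Weil's uniqueness).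
[cite: Balaban1985Averaging, (10) p.19 (bookkeeping); Balaban1987RG1, (0.4) p.253] -/
theorem map_withDensity_eq_smul_of_translations (μ : Measure X) (T : Set (PBond P (j + 1))) [DecidablePred (· ∈ T)]
    {f : X → ℝ≥0∞} (hf : Measurable f) (hfin : ∫⁻ x, f x ∂μ ≠ ∞) {Φ : X → GaugeField P (j + 1) G} (hΦ : Measurable Φ)
    (hR : ∀ h : GaugeField P (j + 1) G, (∀ c, c ∉ T → h c = 1) →
      ∃ R : X → X, MeasurePreserving R μ μ ∧ (∀ x, f (R x) = f x) ∧ (∀ x, Φ (R x) = fun c => Φ x c * h c))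
    (hL : ∀ h : GaugeField P (j + 1) G, (∀ c, c ∈ T → h c = 1) →
      ∃ L : X → X, MeasurePreserving L μ μ ∧ (∀ x, f (L x) = f x) ∧ (∀ x, Φ (L x) = fun c => h c * Φ x c)) :
    (μ.withDensity f).map Φ = (∫⁻ x, f x ∂μ) • fieldMeasure P (j + 1) G := by
  letI : Group (GaugeField P (j + 1) G) := Pi.group
  letI : MeasurableMul₂ (GaugeField P (j + 1) G) := Pi.measurableMul₂
  set ψ : GaugeField P (j + 1) G → GaugeField P (j + 1) G := fun V c => if c ∈ T then V c else (V c)⁻¹ with hψ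
  have hψm : Measurable ψ := measurable_invOff (G := G) T
  have hψψ : ∀ V, ψ (ψ V) = V := fun V => invOff_invOff (G := G) T V
  haveI : IsFiniteMeasure (μ.withDensity f) := isFiniteMeasure_withDensity hfin
  set κ := (μ.withDensity f).map Φ with hκ
  haveI : IsFiniteMeasure κ := Measure.isFiniteMeasure_map _ _
  haveI : IsFiniteMeasure (κ.map ψ) := Measure.isFiniteMeasure_map _ _
  -- (i) right-invariance on `T`
  have hright : ∀ h : GaugeField P (j + 1) G, (∀ c, c ∉ T → h c = 1) → κ.map (fun x => x * h) = κ := by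
    intro h hh
    obtain ⟨R, hRmp, hRf, hRΦ⟩ := hR h hh
    have hcomp : ((fun x => x * h) ∘ Φ) = Φ ∘ R := by
      funext x; show (fun c => Φ x c * h c) = Φ (R x); rw [hRΦ x]
    calc κ.map (fun x => x * h) = (μ.withDensity f).map ((fun x => x * h) ∘ Φ) := by rw [hκ, Measure.map_map (measurable_mul_const h) hΦ]
      _ = (μ.withDensity f).map (Φ ∘ R) := by rw [hcomp]
      _ = ((μ.withDensity f).map R).map Φ := (Measure.map_map hΦ hRmp.measurable).symm
      _ = κ := by rw [map_withDensity_eq_of_comp_eq hRmp hf hRf]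
  -- (ii) left-invariance off `T`
  have hleft : ∀ h : GaugeField P (j + 1) G, (∀ c, c ∈ T → h c = 1) → κ.map (fun x => h * x) = κ := by
    intro h hh
    obtain ⟨Lm, hLmp, hLf, hLΦ⟩ := hL h hh
    have hcomp : ((fun x => h * x) ∘ Φ) = Φ ∘ Lm := by
      funext x; show (fun c => h c * Φ x c) = Φ (Lm x); rw [hLΦ x]
    calc κ.map (fun x => h * x) = (μ.withDensity f).map ((fun x => h * x) ∘ Φ) := by rw [hκ, Measure.map_map (measurable_const_mul h) hΦ]
      _ = (μ.withDensity f).map (Φ ∘ Lm) := by rw [hcomp]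
      _ = ((μ.withDensity f).map Lm).map Φ := (Measure.map_map hΦ hLmp.measurable).symm
      _ = κ := by rw [map_withDensity_eq_of_comp_eq hLmp hf hLf]
  -- (iii) `κ.map ψ` is right-invariant under all translations
  have hinv : ∀ g : GaugeField P (j + 1) G, (κ.map ψ).map (fun x => x * g) = κ.map ψ := by
    intro g
    set gT : GaugeField P (j + 1) G := fun c => if c ∈ T then g c else 1 with hgT
    set gC : GaugeField P (j + 1) G := fun c => if c ∈ T then 1 else (g c)⁻¹ with hgC
    have hgT1 : ∀ c, c ∉ T → gT c = 1 := fun c hc => by simp [hgT, hc]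
    have hgC1 : ∀ c, c ∈ T → gC c = 1 := fun c hc => by simp [hgC, hc]
    have hcomp : ((fun x => x * g) ∘ ψ) = ψ ∘ (fun V => gC * (V * gT)) := by
      funext V; funext c
      show ψ V c * g c = ψ (fun c' => gC c' * (V c' * gT c')) c
      by_cases hc : c ∈ T
      · simp [hψ, hgT, hgC, hc]
      · simp [hψ, hgT, hgC, hc]
    calc (κ.map ψ).map (fun x => x * g) = κ.map ((fun x => x * g) ∘ ψ) := Measure.map_map (measurable_mul_const g) hψm
      _ = κ.map (ψ ∘ (fun V => gC * (V * gT))) := by rw [hcomp]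
      _ = ((κ.map (fun V => V * gT)).map (fun V => gC * V)).map ψ := by
          rw [Measure.map_map hψm (measurable_const_mul gC), Measure.map_map (hψm.comp (measurable_const_mul gC)) (measurable_mul_const gT)]
          rfl
      _ = κ.map ψ := by rw [hright gT hgT1, hleft gC hgC1]
  -- (iv) Weil, then undo `ψ`
  have hW := measure_eq_mass_smul_of_invariant (fieldMeasure P (j + 1) G) (κ.map ψ)
    (fun g => (measurePreserving_mulLeft (P := P) (j := j + 1) g).map_eq) hinv
  have hmass : (κ.map ψ) Set.univ = ∫⁻ x, f x ∂μ := by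
    rw [Measure.map_apply hψm MeasurableSet.univ, Set.preimage_univ, hκ, Measure.map_apply hΦ MeasurableSet.univ, Set.preimage_univ,
      withDensity_apply _ MeasurableSet.univ, Measure.restrict_univ]
  have hback : κ = (κ.map ψ).map ψ := by
    rw [Measure.map_map hψm hψm]
    have : (ψ ∘ ψ) = id := funext fun V => hψψ V
    rw [this, Measure.map_id]
  have hπψ : (fieldMeasure P (j + 1) G).map ψ = fieldMeasure P (j + 1) G := by
    rw [hψ]; exact map_invOff_fieldMeasure (G := G) T
  rw [hback, hW, hmass, Measure.map_smul, hπψ]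

/-- ★ **Probability form**: for a probability `μ` and symmetries of `Φ` alone (`f ≡ 1`), `μ.map Φ = dU_{j+1}` — EXACT Haar-ness of a push-forward from translation symmetries. [folklore] -/
theorem map_eq_haar_of_translations (μ : Measure X) [IsProbabilityMeasure μ] (T : Set (PBond P (j + 1))) [DecidablePred (· ∈ T)]
    {Φ : X → GaugeField P (j + 1) G} (hΦ : Measurable Φ)
    (hR : ∀ h : GaugeField P (j + 1) G, (∀ c, c ∉ T → h c = 1) →
      ∃ R : X → X, MeasurePreserving R μ μ ∧ (∀ x, Φ (R x) = fun c => Φ x c * h c))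
    (hL : ∀ h : GaugeField P (j + 1) G, (∀ c, c ∈ T → h c = 1) →
      ∃ L : X → X, MeasurePreserving L μ μ ∧ (∀ x, Φ (L x) = fun c => h c * Φ x c)) :
    μ.map Φ = fieldMeasure P (j + 1) G := by
  have h1 : ∫⁻ _x, (1 : ℝ≥0∞) ∂μ = 1 := by rw [lintegral_const, measure_univ, mul_one]
  have h := map_withDensity_eq_smul_of_translations (G := G) μ T (f := fun _ => (1 : ℝ≥0∞)) measurable_const (by rw [h1]; exact ENNReal.one_ne_top) hΦ
    (fun h hh => by obtain ⟨R, h1, h2⟩ := hR h hh; exact ⟨R, h1, fun _ => rfl, h2⟩)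
    (fun h hh => by obtain ⟨L, h1, h2⟩ := hL h hh; exact ⟨L, h1, fun _ => rfl, h2⟩)
  rwa [withDensity_const, one_smul, h1, one_smul] at h

end Summit.QuantumFields.YangMills.Theorems.BalabanUVNodesN08LaunderingAbstract

end
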